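import Literature.IUT.HodgeTheaters.PuncturedEllipticArrowModelUnoriented
import HarnessLib

/-!
# The unoriented variant of the [IUTchI] §1 model, part 2: `I_{ε′}·K = I_{ε″}·K = N`, distinct cusps, cusp laws (proof-only)

Mochizuki, *Inter-universal Teichmüller theory I*, kurims manuscript (May 2020), §1 pp. 37–39
([IUTchI] §1 p.38) [claim: Mochizuki2012, status: disputed] (D-0012 claim key; series status DISPUTED —
WITNESS-class, pure finite group theory over `PuncturedEllipticArrowModelUnoriented.lean`; nothing of the
series is asserted, no side is taken on [IUTchIII] Cor. 3.12).

For the unoriented inertia vectors `c′_i = B_i + B_{i+1}` of abc-iut-L5-t1's variant model (part 1): the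
`Δ_ε⁺`-coordinates `ℓ(c′_1) = −1`, `ℓ(c′_{−1}) = 1`, hence `D′_{±1} ⊔ K = N` (the typed clauses
`I_{ε′} ⊔ jKer = I_{ε″} ⊔ jKer = Δ_X̲` of `ArrowCoveringClaims`); distinct cusps have distinct `D′_i`
(support `{i, i+1}`); and the two `Du`-dependent laws of the companion `CuspGalois` (`act_decomp`,
`eq_of_conj`) at the level of `N ⋊ D_l`.  PROOF-ONLY; symbolic `l`; axioms standard.
-/

namespace Literature.IUT.HodgeTheaters

namespace PuncturedEllipticData

namespace ArrowModel

open DihedralGroup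
open scoped Pointwise

variable (l : ℕ)

/-! ### `D′_{±1} ⊔ K = N` -/

/-- A subgroup of `N` containing an element `(w, 1)` with `ℓ(w) = 1` supplements `K`: `H ⊔ K = N`.
([IUTchI] §1 p.38) [claim: Mochizuki2012, status: disputed] -/
theorem sup_Khat_eq_Nhat_of_mem [NeZero l] {H : Subgroup (G l)} (hH : H ≤ Nhat l) {w : V l}
    (hw : inN l w ∈ H) (h1 : ell l w = 1) : H ⊔ Khat l = Nhat l := by
  refine le_antisymm (sup_le hH (Khat_le_Nhat l)) fun g hg => ?_
  rw [eq_inN_of_right_eq_one l ((mem_Nhat_iff l g).mp hg)]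
  set v := Multiplicative.toAdd g.left
  have e : v = (ell l v).val • w + (v - (ell l v).val • w) := by rw [add_sub_cancel]
  rw [e, inN_add]
  refine Subgroup.mul_mem _ (Subgroup.mem_sup_left ?_) (Subgroup.mem_sup_right ?_)
  · rw [inN_nsmul]
    exact Subgroup.pow_mem _ hw _
  · rw [inN_mem_Khat_iff, map_sub, map_nsmul, h1, nsmul_eq_mul, mul_one, ZMod.natCast_zmod_val, sub_self]

/-- `ℓ(c′_1) = −1` (for `3 ≤ l`). [claim: Mochizuki2012, status: disputed] -/
theorem ell_uvec_one (h3 : 3 ≤ l) : ell l (uvec l 1) = -1 := by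
  have h20 : (0 : ZMod l) ≠ 1 + 1 := by
    intro h
    have h' : ((2 : ℕ) : ZMod l) = 0 := by push_cast; linear_combination -h
    exact natCast_ne_zero_of_lt l two_pos (by omega) h'
  have h21 : (1 : ZMod l) ≠ 1 + 1 := by
    intro h
    have h' : ((1 : ℕ) : ZMod l) = 0 := by push_cast; linear_combination -h
    exact natCast_ne_zero_of_lt l one_pos (by omega) h'
  have h10 : (0 : ZMod l) ≠ 1 := by
    intro h
    have h' : ((1 : ℕ) : ZMod l) = 0 := by push_cast; exact h.symm
    exact natCast_ne_zero_of_lt l one_pos (by omega) h'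
  rw [ell_uvec, δ_ne l h10, δ_ne l h20, δ_same, δ_ne l h21]
  ring

/-- `ℓ(c′_{−1}) = 1` (for `3 ≤ l`). [claim: Mochizuki2012, status: disputed] -/
theorem ell_uvec_neg_one (h3 : 3 ≤ l) : ell l (uvec l (-1)) = 1 := by
  have h10 : (1 : ZMod l) ≠ 0 := by exact_mod_cast natCast_ne_zero_of_lt l (a := 1) one_pos (by omega)
  have h20 : (2 : ZMod l) ≠ 0 := by exact_mod_cast natCast_ne_zero_of_lt l (a := 2) two_pos (by omega)
  have hm : (0 : ZMod l) ≠ -1 := fun h => h10 (by linear_combination h)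
  have hm1 : (1 : ZMod l) ≠ -1 := fun h => h20 (by linear_combination h)
  rw [ell_uvec, neg_add_cancel, δ_ne l hm, δ_same, δ_ne l hm1, δ_ne l h10]
  ring

/-- **`D′_1 ⊔ K = N`** (`I_{ε′} ⥲ Δ_ε⁺` in the unoriented variant; generator `−c′_1` has `ℓ = 1`).
([IUTchI] §1 p.38) [claim: Mochizuki2012, status: disputed] -/
theorem Du_one_sup_Khat [NeZero l] (h3 : 3 ≤ l) : Du l 1 ⊔ Khat l = Nhat l := by
  refine sup_Khat_eq_Nhat_of_mem l (Du_le_Nhat l 1) (w := -uvec l 1) ?_ ?_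
  · rw [inN_neg]
    exact (Du l 1).inv_mem (Subgroup.mem_zpowers _)
  · rw [map_neg, ell_uvec_one l h3, neg_neg]

/-- **`D′_{−1} ⊔ K = N`** (`I_{ε″} ⥲ Δ_ε⁺` in the unoriented variant). ([IUTchI] §1 p.38)
[claim: Mochizuki2012, status: disputed] -/
theorem Du_neg_one_sup_Khat [NeZero l] (h3 : 3 ≤ l) : Du l (-1) ⊔ Khat l = Nhat l :=
  sup_Khat_eq_Nhat_of_mem l (Du_le_Nhat l (-1)) (Subgroup.mem_zpowers _) (ell_uvec_neg_one l h3)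

/-- **`¬ D′_1 ≤ K`**: the cusp `ε′` stays ramified in the variant (as the typed claims demand).
([IUTchI] §1 p.39) [claim: Mochizuki2012, status: disputed] -/
theorem not_Du_one_le_Khat (h3 : 3 ≤ l) : ¬ Du l 1 ≤ Khat l := by
  have h10 : (1 : ZMod l) ≠ 0 := by exact_mod_cast natCast_ne_zero_of_lt l (a := 1) one_pos (by omega)
  intro h
  have hmem := (inN_mem_Khat_iff l _).mp (h (Subgroup.mem_zpowers (uhat l 1)))
  rw [ell_uvec_one l h3, neg_eq_zero] at hmem
  exact h10 hmem

/-! ### Distinct cusps have distinct `D′_i` -/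

/-- Distinct cusps have distinct decomposition groups in the variant: `D′_i = D′_j → i = j` (the support
`{i, i+1}` of `c′_i`; needs `2 ≠ 0`, i.e. `3 ≤ l`). ([IUTchI] §1 p.37) [claim: Mochizuki2012, status: disputed] -/
theorem Du_injective (h3 : 3 ≤ l) : Function.Injective (Du l) := by
  have h10 : (1 : ZMod l) ≠ 0 := by exact_mod_cast natCast_ne_zero_of_lt l (a := 1) one_pos (by omega)
  have h20 : (2 : ZMod l) ≠ 0 := by exact_mod_cast natCast_ne_zero_of_lt l (a := 2) two_pos (by omega)
  intro i j hij
  have hmem : uhat l i ∈ Du l j := hij ▸ Subgroup.mem_zpowers _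
  obtain ⟨t, ht⟩ := Subgroup.mem_zpowers_iff.mp hmem
  unfold uhat at ht
  rw [← inN_zsmul] at ht
  have hv := congrArg Prod.snd (inN_injective l ht)
  rw [Prod.smul_snd] at hv
  simp only [uvec] at hv
  -- evaluate `t • c′_j = c′_i` at `i` and at `i + 1`
  have e1 := congrFun hv i
  have e2 := congrFun hv (i + 1)
  simp only [Pi.smul_apply, Pi.add_apply, zsmul_eq_mul] at e1 e2
  rw [δ_same, δ_ne l (show i ≠ i + 1 from fun h => h10 (by linear_combination -h))] at e1
  rw [δ_ne l (show i + 1 ≠ i from fun h => h10 (by linear_combination h)), δ_same] at e2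
  by_contra hne
  by_cases hij1 : i = j + 1
  · -- at `i + 1 = j + 2`: `δ_j(j+2) = δ_{j+1}(j+2) = 0`, contradiction `0 = 1`
    rw [hij1] at e2
    rw [δ_ne l (show j + 1 + 1 ≠ j from fun h => h20 (by linear_combination h)),
      δ_ne l (show j + 1 + 1 ≠ j + 1 from fun h => h10 (by linear_combination h))] at e2
    exact h10 (by linear_combination -e2)
  · -- at `i`: `δ_j(i) = 0`, `δ_{j+1}(i) = 0`
    rw [δ_ne l hne, δ_ne l hij1] at e1
    exact h10 (by linear_combination -e1)

/-! ### The two `D′`-dependent laws of `CuspGalois` at the level of `N ⋊ D_l` -/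

/-- `act_decomp` in the variant, on the nose (`t = 1`). ([IUTchI] §1 p.37) [claim: Mochizuki2012, status: disputed] -/
theorem act_decomp_auxU (g : G l) (i : ZMod l) :
    ∃ t ∈ PiXm l ⊓ PiCbarm l, MulAut.conj (t * g) • Du l i = Du l (actm l g i) :=
  ⟨1, Subgroup.one_mem _, by rw [one_mul, conj_smul_Du, actm_apply]⟩

/-- `eq_of_conj` in the variant. ([IUTchI] §1 p.37) [claim: Mochizuki2012, status: disputed] -/
theorem eq_of_conj_auxU (h3 : 3 ≤ l) (i j : ZMod l) (t : G l) (ht : t ∈ PiXm l ⊓ PiCbarm l)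
    (h : MulAut.conj t • Du l i = Du l j) : i = j := by
  rw [PiXm_inf_PiCbarm, mem_Nhat_iff] at ht
  rw [conj_smul_Du, ht, one_def, cuspAct_r, add_zero] at h
  exact Du_injective l h3 h

/-! ### Contrast: the GENUINE inertia `c_0 = B_1 − B_0` is NOT in `K` -/

/-- `ℓ(c_0) = −2` for the genuine inertia vector of the zero cusp (for `3 ≤ l`). [claim: Mochizuki2012, status: disputed] -/
theorem ell_cvec_zero (h3 : 3 ≤ l) : ell l (cvec l 0) = -2 := by
  have h10 : (1 : ZMod l) ≠ 0 := by exact_mod_cast natCast_ne_zero_of_lt l (a := 1) one_pos (by omega)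
  rw [ell_cvec, zero_add, δ_ne l h10.symm, δ_same, δ_same, δ_ne l h10]
  ring

/-- **`¬ D_0 ≤ K` in the GENUINE model**: there the zero cusp IS ramified in `X̲→ → X̲` (`ℓ(c_0) = −2 ≠ 0`
for `3 ≤ l`). ([IUTchI] §1 p.39) [claim: Mochizuki2012, status: disputed] -/
theorem not_Dm_zero_le_Khat (h3 : 3 ≤ l) : ¬ Dm l 0 ≤ Khat l := by
  have h20 : (2 : ZMod l) ≠ 0 := by exact_mod_cast natCast_ne_zero_of_lt l (a := 2) two_pos (by omega)
  intro h
  have hmem := (inN_mem_Khat_iff l _).mp (h (Subgroup.mem_zpowers (chat l 0)))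
  rw [ell_cvec_zero l h3, neg_eq_zero] at hmem
  exact h20 hmem

end ArrowModel

end PuncturedEllipticData

end Literature.IUT.HodgeTheaters
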